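import Summits.QuantumFields.YangMills.Theorems.UnitScaleTiltFluctuationComparisonRegPrGlobalSlackKernelMatching
import Literature.MathematicalPhysics.QuantumFieldTheory.Balaban1985CMP102.Binders
import Literature.Analysis.Complex.HolomorphicBanach
import HarnessLib

/-!
# `UnitScaleTiltFluctuationComparisonRegPrGlobalSlackKernelCauchyEstimates` — TWO ROWS OF THE K1a INTERFACE DISCHARGED FROM THE DISPLAYED CHART ANALYTICITY
# (crux `FluctuationComparisonRegPrL`, stmt-QuantumFields-19935, STUB 3⁗ `stub_globalTwoRunSlackFam`; width-lever lane A «order-σ matched height-free kernels», step (iii))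

Seat ym-ust-19935-slack g0 (prover).  The K1a kernel-matching interface (`…GlobalSlackKernelMatching`, port of ym-cruxidea-19201-1 g12) composes SIX chart-calculus
rows into the local slack row.  Two of them are NOT independent inputs: they follow from the lane's displayed analyticity row G3D-01
(`Balaban1985CMP102.Binders.ChartAnalyticityAsCited (Ψ X) ρ M`: `Ψ` holomorphic on `ball 0 ρ`, `‖Ψ‖ ≤ M` on `closedBall 0 (ρ/2)`) read for the chart
family, plus print's (32) (no linear term) and the configuration size row.  This file proves exactly that, with explicit constants:

* §1 ONE CHART: `norm_iteratedFDeriv_zero_le_of_chartAnalyticity` — the OPERATOR-NORM Cauchy inequality `‖Dᵈ Ψ(0)‖ ≤ M·(12/ρ)ᵈ` for `d ≤ 6`, from the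
  tree's Banach-space Cauchy inequalities `Literature.Analysis.Complex.HolomorphicBanach.norm_iteratedFDeriv_le_of_closedBall` ([Chae1985] 13.6) at
  `δ = ρ/12`; `…_le_uniform`: the `d`-uniform form `M·(max 1 (12/ρ))⁶`; `abs_re_taylorRest_le`: the seventh-order Taylor rest
  `|Re(Ψ B − Ψ 0 − jet26 Ψ B)| ≤ 2M(2s/ρ)⁷` (`Representation33.norm_sub_sub_jet26_le`, finite-dimensional chart space).
* §2 ROWS in chart-family currency: `ChartAnalyticΦ D Φ κ ρ C_A` (G3D-01 for `Φ K b Y` and for the refined chart `Φ (K+1) (b+1) (refineSet Y)`, bound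
  `C_A·e^{−κ𝓛_K(Y)}` in run `K`'s tree length — the indexing convention of `KernelSizeΦ`/`RemainderSmallΦ`), `Deriv1VanishΦ Φ` ((32): `fderiv (Φ K b Y) 0 = 0`).
* §3 THE CANONICAL TERM FUNCTION OF A CHART FAMILY: `vacOf Φ` (vacuum constants `Re Φ(0)`), `taylorRest Φ B` (the order-≥7 rest), `termOfCharts Φ B Rfar`
  (`Re Φ(B) + Rfar` at term level `b+1`, `0` at level `0`) and `taylorSplit_termOfCharts : TaylorSplitΦ (termOfCharts Φ B Rfar) Φ (vacOf Φ) B (taylorRest Φ B + Rfar)`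
  (an identity).
* §4 DISCHARGES: **`kernelSizeΦ_of_chartAnalytic`** (`ChartAnalyticΦ ⟹ KernelSizeΦ D Φ κ (C_A·(max 1 (12/ρ))⁶)`), `remainderSmallΦ_add`,
  **`remainderSmallΦ_taylorRest`** (`ChartAnalyticΦ ∧ Deriv1VanishΦ ∧ CfgSizeΦ`, window `C_s·θ(n) ≤ ρ/4` ⟹ `RemainderSmallΦ D (taylorRest Φ B) b₀ p₀ κ (2C_A(2C_s/ρ)⁷)`),
  hence `remainderSmallΦ_of_chartAnalytic` for `taylorRest Φ B + Rfar` given the far-terms row `RemainderSmallΦ D Rfar … C_f` (G3D-06 at the birth level).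
After this file the K1a line's independent chart rows are: `ChartAnalyticΦ` (displayed G3D-01), `Deriv1VanishΦ` (displayed (32)), `CfgSizeΦ` ((28)), the far row,
`CfgCauchyΦ` (19200-side) and K1a `FlatKernelCauchyΦ` (the unprinted number comparison).  Every `def` is a hypothesis schema or an explicit construction; nothing
of [Balaban1985UV3]/[King1986] is asserted.

References: T. Bałaban, CMP 102 (1985) 255–275 [Balaban1985UV3] ((28)–(30) p.263, (32)–(34) p.264, (43)–(44) pp.266–267, (57) p.270); C. King, CMP 102 (1986)
649–677 [King1986] (Prop. 3.6 (3.55)–(3.57) p.662); S. B. Chae, Holomorphy and Calculus in Normed Spaces (1985) [Chae1985] (13.6).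
-/

set_option autoImplicit false

noncomputable section

open scoped BigOperators
open Metric Set
open Literature.MathematicalPhysics.QuantumFieldTheory.Balaban1983to89
open Literature.MathematicalPhysics.QuantumFieldTheory.Balaban1983to89.T3ContinuumYM3Torus
open Literature.MathematicalPhysics.QuantumFieldTheory.Balaban1983to89.T3UnitScaleTilt
open Literature.MathematicalPhysics.QuantumFieldTheory.Balaban1983to89.T3LevelShift
open Literature.MathematicalPhysics.QuantumFieldTheory.Balaban1983to89.T3AlphaInputsAC
open Literature.MathematicalPhysics.QuantumFieldTheory.Balaban1983to89.T3AlphaPolymerSocket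
open Literature.MathematicalPhysics.QuantumFieldTheory.Balaban1983to89.T3AlphaInputsACTwoRun
open Literature.MathematicalPhysics.QuantumFieldTheory.Balaban1983to89.T3AlphaInputsACTwoRunLevel
open Literature.MathematicalPhysics.QuantumFieldTheory.Balaban1985CMP102.Binders (ChartAnalyticityAsCited)
open Summit.QuantumFields.Balaban3D.Proofs.Representation33 (jet26 norm_sub_sub_jet26_le)

namespace Summit.QuantumFields.YangMills.Theorems.GlobalSlackKernelMatching

/-! ## §1 One chart: operator-norm Cauchy inequalities for the flat kernels, and the seventh-order Taylor rest -/

section OneChart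

variable {E : Type*} [NormedAddCommGroup E] [NormedSpace ℂ E]

/-- **OPERATOR-NORM CAUCHY INEQUALITY FOR THE FLAT KERNELS, ORDERS `d ≤ 6`**: under G3D-01 (`Ψ` holomorphic on `ball 0 ρ`, `‖Ψ‖ ≤ M` on `closedBall 0 (ρ/2)`),
`‖Dᵈ Ψ(0)‖ ≤ M·(12/ρ)ᵈ` — [Chae1985] 13.6 (tree: `HolomorphicBanach.norm_iteratedFDeriv_le_of_closedBall`) on the ball of radius `ρ/2` with step `δ = ρ/12`
(so `d·δ ≤ ρ/2` for `d ≤ 6`).  This is the «Cauchy estimates + polarisation» behind the printed kernel size (34). [cite: Balaban1985UV3, Prop. 3 (34) p.264] -/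
theorem norm_iteratedFDeriv_zero_le_of_chartAnalyticity {Ψ : E → ℂ} {ρ M : ℝ} (h : ChartAnalyticityAsCited Ψ ρ M)
    {d : ℕ} (hd : d ≤ 6) : ‖iteratedFDeriv ℂ d Ψ 0‖ ≤ M * (12 / ρ) ^ d := by
  obtain ⟨hρ, hdiff, hM⟩ := h
  have hδ : 0 < ρ / 12 := by positivity
  have hsub : closedBall (0 : E) (ρ / 2) ⊆ ball 0 ρ := closedBall_subset_ball (by linarith)
  have hd' : (d : ℝ) ≤ 6 := by exact_mod_cast hd
  have hj : (d : ℝ) * (ρ / 12) ≤ ρ / 2 := by nlinarith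
  have hx : (0 : E) ∈ closedBall (0 : E) (ρ / 2 - d * (ρ / 12)) := mem_closedBall_self (by linarith)
  have key := Literature.Analysis.Complex.HolomorphicBanach.norm_iteratedFDeriv_le_of_closedBall hdiff isOpen_ball hsub hM hδ d hj hx
  calc ‖iteratedFDeriv ℂ d Ψ 0‖ ≤ M / (ρ / 12) ^ d := key
    _ = M * (12 / ρ) ^ d := by rw [div_eq_mul_inv, ← inv_pow, inv_div]

/-- The `d`-uniform form for `d ≤ 6`: `‖Dᵈ Ψ(0)‖ ≤ M·(max 1 (12/ρ))⁶`. [cite: Balaban1985UV3, Prop. 3 (34) p.264] -/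
theorem norm_iteratedFDeriv_zero_le_uniform {Ψ : E → ℂ} {ρ M : ℝ} (h : ChartAnalyticityAsCited Ψ ρ M)
    {d : ℕ} (hd : d ≤ 6) : ‖iteratedFDeriv ℂ d Ψ 0‖ ≤ M * (max 1 (12 / ρ)) ^ 6 := by
  have hM : 0 ≤ M := h.bound_nonneg
  have hρ : 0 < ρ := h.1
  refine (norm_iteratedFDeriv_zero_le_of_chartAnalyticity h hd).trans (mul_le_mul_of_nonneg_left ?_ hM)
  have h1 : (12 / ρ) ^ d ≤ (max 1 (12 / ρ)) ^ d := pow_le_pow_left₀ (by positivity) (le_max_right _ _) d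
  have h2 : (max 1 (12 / ρ)) ^ d ≤ (max 1 (12 / ρ)) ^ 6 := pow_le_pow_right₀ (le_max_left _ _) hd
  exact h1.trans h2

/-- **THE SEVENTH-ORDER TAYLOR REST OF ONE CHART, REAL PART**: under G3D-01, (32) (`DΨ(0) = 0`) and `‖B‖ ≤ s ≤ ρ/4`,
`|Re(Ψ B − Ψ 0 − jet26 Ψ B)| ≤ 2M(2s/ρ)⁷` (`Representation33.norm_sub_sub_jet26_le`; finite-dimensional chart space). [cite: Balaban1985UV3, (30)+(32) pp.263–264, (57) p.270] -/
theorem abs_re_taylorRest_le [FiniteDimensional ℂ E] {Ψ : E → ℂ} {ρ M s : ℝ} (h : ChartAnalyticityAsCited Ψ ρ M)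
    (h32 : fderiv ℂ Ψ 0 = 0) (hs : 0 ≤ s) (hsρ : s ≤ ρ / 4) {B : E} (hB : ‖B‖ ≤ s) :
    |(Ψ B - Ψ 0 - jet26 Ψ B).re| ≤ 2 * M * (2 * s / ρ) ^ 7 :=
  (Complex.abs_re_le_norm _).trans (norm_sub_sub_jet26_le h.1 h.2.1 h.2.2 h32 hs hsρ hB)

end OneChart

/-! ## §2 The displayed rows in chart-family currency -/

section Rows

variable {𝕍 : Type} [NormedAddCommGroup 𝕍] [NormedSpace ℂ 𝕍] {F : T3Family} {γ : ℝ}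

/-- **CHART ANALYTICITY ROW** (G3D-01 in chart-family currency; hypothesis schema, never asserted): for every listed domain `Y ∈ Loc K k triv (1+b)` the chart
`Φ K b Y` AND the refined chart `Φ (K+1) (b+1) (refineSet Y)` are holomorphic on `ball 0 ρ` and bounded by `C_A·e^{−κ𝓛_K(Y)}` on `closedBall 0 (ρ/2)` — the lane's
displayed `chart` row `ChartAnalyticityAsCited (Ψ X) ρ (C25·g_k·e^{−κ dj X})` (with `g_k ≤ 1` given away), both runs indexed by run `K`'s tree length as in
`KernelSizeΦ`/`RemainderSmallΦ`. [cite: Balaban1985UV3, (25) p.262, (29)–(30) p.263; Balaban1985Variational, (158) p.302, Prop. 9 p.309] -/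
def ChartAnalyticΦ (D : AlphaDataT3 F γ) (Φ : ChartFam 𝕍 F) (κ ρ C_A : ℝ) : Prop :=
  ∀ (K k b : ℕ) (Y : Set (Site (F.P K) 0)), Y ∈ D.Loc K k (D.triv K k) (1 + b) →
    ChartAnalyticityAsCited (Φ K b Y) ρ (C_A * Real.exp (-κ * D.treeLen K (1 + b) Y)) ∧
    ChartAnalyticityAsCited (Φ (K + 1) (b + 1) (refineSet F K Y)) ρ (C_A * Real.exp (-κ * D.treeLen K (1 + b) Y))

/-- **NO LINEAR TERM** ((32) p.264 in chart-family currency; hypothesis schema, never asserted): every chart has vanishing first derivative at the flat point —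
«for semi-simple G there are no invariant vectors … (δ/δ𝓗(b) 𝒫′₁)(g₀, X, 1) = 0» (tree: `B10.invariant_vector_eq_zero`, the lane's `eq32`). [cite: Balaban1985UV3, (31)–(32) p.264] -/
def Deriv1VanishΦ (Φ : ChartFam 𝕍 F) : Prop :=
  ∀ (K b : ℕ) (Y : Set (Site (F.P K) 0)), fderiv ℂ (Φ K b Y) 0 = 0

end Rows

/-! ## §3 The canonical term function, vacuum constants and Taylor rest of a chart family -/

section Canonical

variable {𝕍 : Type} [NormedAddCommGroup 𝕍] [NormedSpace ℂ 𝕍] {F : T3Family}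

/-- VACUUM CONSTANTS of a chart family: `e K b Y := Re Φ K b Y (0)` (order 0 of (30), `𝒫′(g, Y, 1)`). [cite: Balaban1985UV3, (30)–(31) p.263] -/
def vacOf (Φ : ChartFam 𝕍 F) : VacFam F := fun K b Y => (Φ K b Y 0).re

/-- THE TAYLOR REST of a chart family at a configuration family: `Re(Φ(B) − Φ(0) − jet26 Φ B)` (orders `≥ 7` of (30), under (32)). [cite: Balaban1985UV3, (30) p.263, (57) p.270] -/
def taylorRest (Φ : ChartFam 𝕍 F) (B : CfgFam 𝕍 F) : RemFam F :=
  fun K k b Y W => (Φ K b Y (B K k b Y W) - Φ K b Y 0 - jet26 (Φ K b Y) (B K k b Y W)).re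

/-- THE CANONICAL TERM FUNCTION of a chart family, a configuration family and a far-terms family: at term level `b + 1`, `Re Φ K b Y (B K k b Y W) + Rfar K k b Y W`
(the lane's `act = Re Ψ_X(B_X)` plus the booked far terms); no terms at level `0`. [cite: Balaban1985UV3, (29) p.263, (33) p.264, (43) p.266] -/
def termOfCharts (Φ : ChartFam 𝕍 F) (B : CfgFam 𝕍 F) (Rfar : RemFam F) : TermFn F :=
  fun K k i Y W => if i = 0 then 0 else (Φ K (i - 1) Y (B K k (i - 1) Y W)).re + Rfar K k (i - 1) Y W

omit [NormedAddCommGroup 𝕍] [NormedSpace ℂ 𝕍] in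
/-- The canonical term function at term level `1 + b` (bookkeeping). [cite: Balaban1985UV3, (43) p.266] -/
theorem termOfCharts_succ (Φ : ChartFam 𝕍 F) (B : CfgFam 𝕍 F) (Rfar : RemFam F) (K k b : ℕ) (Y : Set (Site (F.P K) 0))
    (W : GaugeField (F.P K) k (Matrix.specialUnitaryGroup (Fin 2) ℂ)) :
    termOfCharts Φ B Rfar K k (1 + b) Y W = (Φ K b Y (B K k b Y W)).re + Rfar K k b Y W := by
  have h1 : 1 + b ≠ 0 := by omega
  have h2 : 1 + b - 1 = b := by omega
  simp only [termOfCharts, if_neg h1]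
  rw [h2]

/-- **THE TAYLOR STRUCTURE ROW HOLDS FOR THE CANONICAL TERM FUNCTION — AN IDENTITY**: `termOfCharts Φ B Rfar = vacOf Φ + Re jet26(Φ)(B) + (taylorRest Φ B + Rfar)`
at every term level `1 + b`. [cite: Balaban1985UV3, (30) p.263, (43) p.266] -/
theorem taylorSplit_termOfCharts (Φ : ChartFam 𝕍 F) (B : CfgFam 𝕍 F) (Rfar : RemFam F) :
    TaylorSplitΦ (termOfCharts Φ B Rfar) Φ (vacOf Φ) B (taylorRest Φ B + Rfar) := by
  intro K k b Y W
  rw [termOfCharts_succ]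
  simp only [vacOf, taylorRest, Pi.add_apply, Complex.sub_re]
  ring

/-- The bond transport does not increase the sup norm (it re-indexes the components along `matchBond⁻¹`). [cite: Balaban1987RG1, (0.1) p.251] -/
theorem norm_transport_le (K b : ℕ) (x : PBond (F.P K) b → 𝕍) : ‖transport 𝕍 F K b x‖ ≤ ‖x‖ :=
  (pi_norm_le_iff_of_nonneg (norm_nonneg x)).2 fun c' => by
    rw [transport_apply]
    exact norm_le_pi_norm x _

end Canonical

/-! ## §4 The discharges: `KernelSizeΦ` and the Taylor part of `RemainderSmallΦ` from `ChartAnalyticΦ` -/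

section Discharge

variable {𝕍 : Type} [NormedAddCommGroup 𝕍] [NormedSpace ℂ 𝕍] {F : T3Family} {γ : ℝ}

/-- **`KernelSizeΦ` IS A THEOREM UNDER G3D-01**: `ChartAnalyticΦ D Φ κ ρ C_A ⟹ KernelSizeΦ D Φ κ (C_A·(max 1 (12/ρ))⁶)` — the printed kernel size (34) by the
operator-norm Cauchy inequalities of §1 (orders `2 ≤ d ≤ 6`). [cite: Balaban1985UV3, Prop. 3 (34) p.264; King1986, (3.55) p.662] -/
theorem kernelSizeΦ_of_chartAnalytic {D : AlphaDataT3 F γ} {Φ : ChartFam 𝕍 F} {κ ρ C_A : ℝ}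
    (h : ChartAnalyticΦ D Φ κ ρ C_A) : KernelSizeΦ D Φ κ (C_A * (max 1 (12 / ρ)) ^ 6) := by
  intro K k b Y hY d hd
  have hd6 : d ≤ 6 := by have := (Finset.mem_Ico.mp hd).2; omega
  have key := norm_iteratedFDeriv_zero_le_uniform (h K k b Y hY).1 hd6
  calc ‖ker Φ K b Y d‖ = ‖iteratedFDeriv ℂ d (Φ K b Y) 0‖ := rfl
    _ ≤ C_A * Real.exp (-κ * D.treeLen K (1 + b) Y) * (max 1 (12 / ρ)) ^ 6 := key
    _ = C_A * (max 1 (12 / ρ)) ^ 6 * Real.exp (-κ * D.treeLen K (1 + b) Y) := by ring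

/-- `RemainderSmallΦ` is additive in the rest (constants add). [folklore] -/
theorem remainderSmallΦ_add {D : AlphaDataT3 F γ} {R₁ R₂ : RemFam F} {b₀ p₀ κ C₁ C₂ : ℝ}
    (h₁ : RemainderSmallΦ D R₁ b₀ p₀ κ C₁) (h₂ : RemainderSmallΦ D R₂ b₀ p₀ κ C₂) :
    RemainderSmallΦ D (R₁ + R₂) b₀ p₀ κ (C₁ + C₂) := by
  intro K n hn j hj V hV Y hY
  obtain ⟨a₁, b₁⟩ := h₁ K n hn j hj V hV Y hY
  obtain ⟨a₂, b₂⟩ := h₂ K n hn j hj V hV Y hY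
  simp only [Pi.add_apply]
  refine ⟨(abs_add_le _ _).trans ((add_le_add a₁ a₂).trans (le_of_eq (by ring))),
    (abs_add_le _ _).trans ((add_le_add b₁ b₂).trans (le_of_eq (by ring)))⟩

/-- The arithmetic of the Taylor rest: `2·(C_A·e)·(2·(C_s·θ·x²)/ρ)⁷ ≤ (2C_A(2C_s/ρ)⁷)·e·θ⁷·x⁴` for `0 ≤ x ≤ 1` (the level factor `x¹⁴ ≤ x⁴`) and nonnegative
letters. [folklore] -/
theorem taylorRest_arith {C_A C_s ρ e θ x : ℝ} (hCA : 0 ≤ C_A) (hCs : 0 ≤ C_s) (hρ : 0 < ρ) (he : 0 ≤ e) (hθ : 0 ≤ θ)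
    (hx0 : 0 ≤ x) (hx1 : x ≤ 1) :
    2 * (C_A * e) * (2 * (C_s * θ * x ^ 2) / ρ) ^ 7 ≤ 2 * C_A * (2 * C_s / ρ) ^ 7 * e * θ ^ 7 * x ^ 4 := by
  have hx14 : x ^ 14 ≤ x ^ 4 := pow_le_pow_of_le_one hx0 hx1 (by norm_num)
  have heq : 2 * (C_A * e) * (2 * (C_s * θ * x ^ 2) / ρ) ^ 7 = 2 * C_A * (2 * C_s / ρ) ^ 7 * e * θ ^ 7 * x ^ 14 := by ring
  rw [heq]
  have hcoef : 0 ≤ 2 * C_A * (2 * C_s / ρ) ^ 7 * e * θ ^ 7 := by positivity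
  exact mul_le_mul_of_nonneg_left hx14 hcoef

/-- **THE TAYLOR PART OF `RemainderSmallΦ` IS A THEOREM UNDER G3D-01 + (32) + (28)**: for a finite-dimensional colour space, `ChartAnalyticΦ D Φ κ ρ C_A`,
`Deriv1VanishΦ Φ`, `CfgSizeΦ D B b₀ p₀ C_s` and the window `C_s·θ(n) ≤ ρ/4` give `RemainderSmallΦ D (taylorRest Φ B) b₀ p₀ κ (2C_A(2C_s/ρ)⁷)` — (57) p.270
«terms with an overall power greater than six» for BOTH runs (run `K+1`'s configuration is the transport of its pull-back, `transport_pullback`, and the transport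
does not increase the sup norm). [cite: Balaban1985UV3, (28)–(30) p.263, (32) p.264, (57) p.270] -/
theorem remainderSmallΦ_taylorRest [FiniteDimensional ℂ 𝕍] {D : AlphaDataT3 F γ} {Φ : ChartFam 𝕍 F} {B : CfgFam 𝕍 F}
    {b₀ p₀ κ ρ C_A C_s : ℝ} (hCA : 0 ≤ C_A) (hCs : 0 ≤ C_s) (hρ : 0 < ρ) (hL : 1 ≤ (F.L : ℝ))
    (hθ0 : ∀ n, 0 ≤ θBal F.L γ b₀ p₀ n) (hwin : ∀ n, C_s * θBal F.L γ b₀ p₀ n ≤ ρ / 4)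
    (hA : ChartAnalyticΦ D Φ κ ρ C_A) (h32 : Deriv1VanishΦ Φ) (hS : CfgSizeΦ D B b₀ p₀ C_s) :
    RemainderSmallΦ D (taylorRest Φ B) b₀ p₀ κ (2 * C_A * (2 * C_s / ρ) ^ 7) := by
  intro K n hn j hj V hV Y hY
  obtain ⟨hA0, hA1⟩ := hA K (K - n) j Y hY
  obtain ⟨hS0, hS1⟩ := hS K n hn j hj V hV Y hY
  have hx0 : 0 ≤ ((F.L : ℝ) ^ (K - n - 1 - j))⁻¹ := by positivity
  have hx1 : ((F.L : ℝ) ^ (K - n - 1 - j))⁻¹ ≤ 1 := inv_le_one_of_one_le₀ (one_le_pow₀ hL)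
  have hs0 : 0 ≤ C_s * θBal F.L γ b₀ p₀ n * (((F.L : ℝ) ^ (K - n - 1 - j))⁻¹) ^ 2 := by
    have := hθ0 n; positivity
  have hsρ : C_s * θBal F.L γ b₀ p₀ n * (((F.L : ℝ) ^ (K - n - 1 - j))⁻¹) ^ 2 ≤ ρ / 4 :=
    (mul_le_of_le_one_right (mul_nonneg hCs (hθ0 n)) (pow_le_one₀ hx0 hx1)).trans (hwin n)
  have he : 0 ≤ Real.exp (-κ * D.treeLen K (1 + j) Y) := (Real.exp_pos _).le
  refine ⟨?_, ?_⟩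
  · -- run `K`
    have key := abs_re_taylorRest_le hA0 (h32 K j Y) hs0 hsρ hS0
    exact key.trans (taylorRest_arith hCA hCs hρ he (hθ0 n) hx0 hx1)
  · -- run `K+1`: its configuration is the transport of the pull-back, whose norm the size row bounds
    set B₁ : PBond (F.P K) j → 𝕍 := fun c => B (K + 1) (K + 1 - n) (j + 1) (refineSet F K Y)
      (fieldShift (F.sitesPerDir_eq (m := F.m) (K := K + 1) (j := K + 1 - n) (m' := F.m) (K' := n) (j' := 0) (by omega)) V)
      (matchBond F K j c) with hB₁
    have hpull : B (K + 1) (K + 1 - n) (j + 1) (refineSet F K Y)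
        (fieldShift (F.sitesPerDir_eq (m := F.m) (K := K + 1) (j := K + 1 - n) (m' := F.m) (K' := n) (j' := 0) (by omega)) V) =
        transport 𝕍 F K j B₁ := (transport_pullback K j _).symm
    have hB' : ‖B (K + 1) (K + 1 - n) (j + 1) (refineSet F K Y)
        (fieldShift (F.sitesPerDir_eq (m := F.m) (K := K + 1) (j := K + 1 - n) (m' := F.m) (K' := n) (j' := 0) (by omega)) V)‖ ≤
        C_s * θBal F.L γ b₀ p₀ n * (((F.L : ℝ) ^ (K - n - 1 - j))⁻¹) ^ 2 := by
      rw [hpull]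
      exact (norm_transport_le K j B₁).trans hS1
    have key := abs_re_taylorRest_le hA1 (h32 (K + 1) (j + 1) (refineSet F K Y)) hs0 hsρ hB'
    exact key.trans (taylorRest_arith hCA hCs hρ he (hθ0 n) hx0 hx1)

/-- **THE FULL REMAINDER ROW FROM THE DISPLAYED ROWS**: the Taylor rest (§4) plus the far-terms row `RemainderSmallΦ D Rfar b₀ p₀ κ C_f` (the lane's displayed G3D-06
`far_le` at the birth level; the `Rfar` of (M1) at the old levels) give `RemainderSmallΦ D (taylorRest Φ B + Rfar) b₀ p₀ κ (2C_A(2C_s/ρ)⁷ + C_f)` — the `R` of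
`taylorSplit_termOfCharts`. [cite: Balaban1985UV3, (57) p.270, p.264 L15-16] -/
theorem remainderSmallΦ_of_chartAnalytic [FiniteDimensional ℂ 𝕍] {D : AlphaDataT3 F γ} {Φ : ChartFam 𝕍 F} {B : CfgFam 𝕍 F} {Rfar : RemFam F}
    {b₀ p₀ κ ρ C_A C_s C_f : ℝ} (hCA : 0 ≤ C_A) (hCs : 0 ≤ C_s) (hρ : 0 < ρ) (hL : 1 ≤ (F.L : ℝ))
    (hθ0 : ∀ n, 0 ≤ θBal F.L γ b₀ p₀ n) (hwin : ∀ n, C_s * θBal F.L γ b₀ p₀ n ≤ ρ / 4)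
    (hA : ChartAnalyticΦ D Φ κ ρ C_A) (h32 : Deriv1VanishΦ Φ) (hS : CfgSizeΦ D B b₀ p₀ C_s) (hfar : RemainderSmallΦ D Rfar b₀ p₀ κ C_f) :
    RemainderSmallΦ D (taylorRest Φ B + Rfar) b₀ p₀ κ (2 * C_A * (2 * C_s / ρ) ^ 7 + C_f) :=
  remainderSmallΦ_add (remainderSmallΦ_taylorRest hCA hCs hρ hL hθ0 hwin hA h32 hS) hfar

end Discharge

end Summit.QuantumFields.YangMills.Theorems.GlobalSlackKernelMatching

end
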